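import Summits.SmoothPoincare4.SmoothPoincare4.Theorems.ConvexBisectionAcyclicBisectionExistsBeltFibreFraming
import HarnessLib

/-!
# The framed `r`-longitude of an attaching circle, V: the radial isotopy between longitudes, carrying the
# one-twist fibre framing (stage (3c) of node T3c-1, first half)
(node T3c-1 `node_belt_isotopic_pushoff` of the sub-goal T3 of stub `stub_steinRealisation` (NF6), line
`modp-braid-orbits`, crux `ConvexBisection.AcyclicBisectionExists`, item stmt-SmoothPoincare4-10508;
wave 3, worker Z5, lead c5)

For an attaching map `h̄ : T → W` of a 2-handle, a direction flag `b` and two radii `ρ₀, ρ₁ ∈ (0, 1)`, the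
`h̄`-images of the longitudes `θ ↦ (√(1-ρ²) u_b(θ), ρ θ)` of the attaching circle move into each other by
changing the radius:

* §1 the radius schedule `radSched ρ₀ ρ₁ t = ρ₀ + smoothTransition(t) (ρ₁ − ρ₀)` (in `[ρ₀, ρ₁]` for all `t`,
  `ρ₀` at `t = 0`, `ρ₁` at `t = 1`, smooth);
* §2 **`radialIsotopy h̄ b ρ₀ ρ₁ : KnotIsotopyInBoundary (h̄ ∘ ℓ^{ρ₀}) (h̄ ∘ ℓ^{ρ₁})`** with stages
  `θ ↦ h̄ (depthLine (uDir b θ) (ρ(t) θ) 0)` (each an embedded longitude, in `∂W`, jointly smooth);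
* §3 **`isFramingAlong_radial`** — the one-twist fibre framings `tubeFibreFraming h̄ (uDir b θ) (ρ(t) θ) θ²`
  are carried along it (`IsKnotFraming` at every stage: continuity by `continuous_tubeFibreFraming`,
  tangency, and transversality read in `ℝ⁴` — `X_{θ²} = θ₀ X_θ + θ₁ X_{iθ}` is never a multiple of the
  velocity `2π V`; joint continuity by `continuous_tubeFibreFraming` over `ℝ × 𝕊¹`); all stages lie in
  `h̄(T)` off the core (`radialIsotopy_mem`);
* §4 registered helper `helper_belt_radialIsotopy`.

Everything is proved; no named facts.

## References
* A. A. Kosinski, *Differential Manifolds*, Academic Press (1993), VI §6. [Kosinski1993]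
* R. C. Kirby, *The Topology of 4-Manifolds*, LNM 1374 (1989), Ch. I §2 (framings). [Kirby1989]
-/

noncomputable section

-- the prescribed namespace `Summit.<P>.<Sub>.…` duplicates `SmoothPoincare4` (P = Sub)
set_option linter.dupNamespace false

open scoped Manifold ContDiff Topology RealInnerProductSpace
open Set Function Metric Real Bundle

namespace Summit.SmoothPoincare4.SmoothPoincare4.Theorems.AcyclicBisectionExists.ModpBraidOrbits

open Literature.Topology.FourManifolds Literature.Topology.FourManifolds.HandleAttachingMap
  Literature.Geometry.Symplectic

/-! ### §1 The radius schedule -/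

/-- **The radius schedule** `ρ(t) = ρ₀ + smoothTransition(t) (ρ₁ − ρ₀)`: `ρ₀` for `t ≤ 0`, `ρ₁` for `t ≥ 1`,
always between `ρ₀` and `ρ₁`. [folklore] -/
def radSched (ρ₀ ρ₁ t : ℝ) : ℝ := ρ₀ + Real.smoothTransition t * (ρ₁ - ρ₀)

/-- `ρ(0) = ρ₀`. [folklore] -/
@[simp] theorem radSched_zero (ρ₀ ρ₁ : ℝ) : radSched ρ₀ ρ₁ 0 = ρ₀ := by
  simp [radSched, Real.smoothTransition.zero_of_nonpos le_rfl]

/-- `ρ(1) = ρ₁`. [folklore] -/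
@[simp] theorem radSched_one (ρ₀ ρ₁ : ℝ) : radSched ρ₀ ρ₁ 1 = ρ₁ := by
  simp [radSched, Real.smoothTransition.one_of_one_le le_rfl]

/-- The schedule is smooth. [folklore] -/
theorem contDiff_radSched (ρ₀ ρ₁ : ℝ) : ContDiff ℝ ∞ (radSched ρ₀ ρ₁) :=
  contDiff_const.add (Real.smoothTransition.contDiff.mul contDiff_const)

/-- `min ρ₀ ρ₁ ≤ ρ(t)`. [folklore] -/
theorem min_le_radSched (ρ₀ ρ₁ t : ℝ) : min ρ₀ ρ₁ ≤ radSched ρ₀ ρ₁ t := by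
  have hs0 := Real.smoothTransition.nonneg t
  have hs1 := Real.smoothTransition.le_one t
  unfold radSched
  nlinarith [mul_nonneg hs0 (sub_nonneg.2 (min_le_right ρ₀ ρ₁)),
    mul_nonneg (sub_nonneg.2 hs1) (sub_nonneg.2 (min_le_left ρ₀ ρ₁))]

/-- `ρ(t) ≤ max ρ₀ ρ₁`. [folklore] -/
theorem radSched_le_max (ρ₀ ρ₁ t : ℝ) : radSched ρ₀ ρ₁ t ≤ max ρ₀ ρ₁ := by
  have hs0 := Real.smoothTransition.nonneg t
  have hs1 := Real.smoothTransition.le_one t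
  unfold radSched
  nlinarith [mul_nonneg hs0 (sub_nonneg.2 (le_max_right ρ₀ ρ₁)),
    mul_nonneg (sub_nonneg.2 hs1) (sub_nonneg.2 (le_max_left ρ₀ ρ₁))]

/-- The schedule stays between positive radii below `1`: `0 < ρ(t)`. [folklore] -/
theorem radSched_pos {ρ₀ ρ₁ : ℝ} (h0 : 0 < ρ₀) (h1 : 0 < ρ₁) (t : ℝ) : 0 < radSched ρ₀ ρ₁ t :=
  lt_of_lt_of_le (lt_min h0 h1) (min_le_radSched ρ₀ ρ₁ t)

/-- The schedule stays between positive radii below `1`: `ρ(t) < 1`. [folklore] -/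
theorem radSched_lt_one {ρ₀ ρ₁ : ℝ} (h0 : ρ₀ < 1) (h1 : ρ₁ < 1) (t : ℝ) : radSched ρ₀ ρ₁ t < 1 :=
  lt_of_le_of_lt (radSched_le_max ρ₀ ρ₁ t) (max_lt h0 h1)

/-! ### §2 The radial isotopy of longitudes -/

section Radial

variable {W : Type*} [TopologicalSpace W] [T2Space W] [ChartedSpace (EuclideanHalfSpace 4) W]
  [IsManifold (𝓡∂ 4) ∞ W] (f : HandleAttachingMap 3 2 W) (b : Bool)

omit [T2Space W] [IsManifold (𝓡∂ 4) ∞ W] in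
/-- The stage map of the radial isotopy is the `h̄`-image of the `ρ(t)`-longitude. [folklore] -/
theorem radialStage_eq {ρ₀ ρ₁ : ℝ} (h0 : 0 < ρ₀) (h0' : ρ₀ < 1) (h1 : 0 < ρ₁) (h1' : ρ₁ < 1) (t : ℝ) :
    (fun θ : sphere (0 : EuclideanSpace ℝ (Fin 2)) 1 =>
      f.toFun (depthLine (uDir b θ) (radSched ρ₀ ρ₁ t • (θ : EuclideanSpace ℝ (Fin 2))) 0)) =
      fun θ => f.toFun (tubeLongitudePt b (radSched ρ₀ ρ₁ t) θ) :=
  funext fun θ => by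
    rw [depthLine_uDir_smul b (radSched_pos h0 h1 t).le (radSched_lt_one h0' h1' t) θ]

/-- **The radial isotopy of longitudes** `t ↦ (θ ↦ h̄ (depthLine (uDir b θ) (ρ(t) θ) 0))` from the
`ρ₀`-longitude to the `ρ₁`-longitude of the attaching circle, as an isotopy of knots in `∂W`
(`0 < ρ₀, ρ₁ < 1`). [cite: Kosinski1993, VI §6] -/
def radialIsotopy {ρ₀ ρ₁ : ℝ} (h0 : 0 < ρ₀) (h0' : ρ₀ < 1) (h1 : 0 < ρ₁) (h1' : ρ₁ < 1) :
    KnotIsotopyInBoundary (fun θ => f.toFun (tubeLongitudePt b ρ₀ θ)) (fun θ => f.toFun (tubeLongitudePt b ρ₁ θ)) where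
  toFun t θ := f.toFun (depthLine (uDir b θ) (radSched ρ₀ ρ₁ t • (θ : EuclideanSpace ℝ (Fin 2))) 0)
  contMDiff := by
    haveI := Fact.mk (@finrank_euclideanSpace_fin ℝ _ 2)
    have hρ : ContMDiff (𝓘(ℝ, ℝ).prod (𝓡 1)) 𝓘(ℝ, ℝ) ∞
        fun p : ℝ × (sphere (0 : EuclideanSpace ℝ (Fin 2)) 1) => radSched ρ₀ ρ₁ p.1 :=
      (contDiff_radSched ρ₀ ρ₁).contMDiff.comp contMDiff_fst
    have hθ : ContMDiff (𝓘(ℝ, ℝ).prod (𝓡 1)) 𝓘(ℝ, EuclideanSpace ℝ (Fin 2)) ∞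
        fun p : ℝ × (sphere (0 : EuclideanSpace ℝ (Fin 2)) 1) => ((p.2 : sphere (0 : EuclideanSpace ℝ (Fin 2)) 1) :
          EuclideanSpace ℝ (Fin 2)) :=
      contMDiff_coe_sphere.comp contMDiff_snd
    have hq : ContMDiff (𝓘(ℝ, ℝ).prod (𝓡 1)) ((𝓡 1).prod 𝓘(ℝ, EuclideanSpace ℝ (Fin 2))) ∞
        fun p : ℝ × (sphere (0 : EuclideanSpace ℝ (Fin 2)) 1) =>
          ((uDir b p.2, radSched ρ₀ ρ₁ p.1 • ((p.2 : sphere (0 : EuclideanSpace ℝ (Fin 2)) 1) : EuclideanSpace ℝ (Fin 2))) :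
            (sphere (0 : EuclideanSpace ℝ (Fin 2)) 1) × EuclideanSpace ℝ (Fin 2)) :=
      ((contMDiff_uDir b).comp contMDiff_snd).prodMk (hρ.smul hθ)
    have hmaps : MapsTo (fun p : ℝ × (sphere (0 : EuclideanSpace ℝ (Fin 2)) 1) =>
          ((uDir b p.2, radSched ρ₀ ρ₁ p.1 • ((p.2 : sphere (0 : EuclideanSpace ℝ (Fin 2)) 1) : EuclideanSpace ℝ (Fin 2))) :
            (sphere (0 : EuclideanSpace ℝ (Fin 2)) 1) × EuclideanSpace ℝ (Fin 2))) univ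
        ((univ : Set (sphere (0 : EuclideanSpace ℝ (Fin 2)) 1)) ×ˢ ball (0 : EuclideanSpace ℝ (Fin 2)) 1) := by
      intro p _
      refine ⟨mem_univ _, ?_⟩
      rw [mem_ball_zero_iff, norm_smul_coe_sphere' (radSched_pos h0 h1 p.1).le]
      exact radSched_lt_one h0' h1' p.1
    have h := (contMDiffOn_sphereTubeMap f).comp hq.contMDiffOn hmaps
    exact contMDiffOn_univ.1 h
  isSmoothEmbedding t := by
    rw [radialStage_eq f b h0 h0' h1 h1' t]
    exact isSmoothEmbedding_longitude f b (radSched_pos h0 h1 t).le (radSched_lt_one h0' h1' t)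
  map_zero := by
    funext θ
    show f.toFun (depthLine (uDir b θ) (radSched ρ₀ ρ₁ 0 • (θ : EuclideanSpace ℝ (Fin 2))) 0) =
      f.toFun (tubeLongitudePt b ρ₀ θ)
    rw [radSched_zero, depthLine_uDir_smul b h0.le h0' θ]
  map_one := by
    funext θ
    show f.toFun (depthLine (uDir b θ) (radSched ρ₀ ρ₁ 1 • (θ : EuclideanSpace ℝ (Fin 2))) 0) =
      f.toFun (tubeLongitudePt b ρ₁ θ)
    rw [radSched_one, depthLine_uDir_smul b h1.le h1' θ]
  isBoundaryPoint t _ θ := f.isBoundaryPoint _ (norm_tubeVec_depthLine_zero _ _)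

/-- Stages of the radial isotopy. [folklore] -/
@[simp] theorem radialIsotopy_toFun {ρ₀ ρ₁ : ℝ} (h0 : 0 < ρ₀) (h0' : ρ₀ < 1) (h1 : 0 < ρ₁) (h1' : ρ₁ < 1)
    (t : ℝ) (θ : sphere (0 : EuclideanSpace ℝ (Fin 2)) 1) :
    (radialIsotopy f b h0 h0' h1 h1').toFun t θ =
      f.toFun (depthLine (uDir b θ) (radSched ρ₀ ρ₁ t • (θ : EuclideanSpace ℝ (Fin 2))) 0) := rfl

omit [T2Space W] [IsManifold (𝓡∂ 4) ∞ W] in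
/-- **The stages of the radial isotopy lie in `h̄(T)` off the core** (they are `h̄` of sphere points with
fibre of norm `ρ(t) ∈ (0, 1)`). [folklore] -/
theorem radialIsotopy_mem {ρ₀ ρ₁ : ℝ} (h0 : 0 < ρ₀) (h0' : ρ₀ < 1) (h1 : 0 < ρ₁) (h1' : ρ₁ < 1)
    (t : ℝ) (θ : sphere (0 : EuclideanSpace ℝ (Fin 2)) 1) :
    f.toFun (depthLine (uDir b θ) (radSched ρ₀ ρ₁ t • (θ : EuclideanSpace ℝ (Fin 2))) 0) ∈ range f.toFun ∧
      f.toFun (depthLine (uDir b θ) (radSched ρ₀ ρ₁ t • (θ : EuclideanSpace ℝ (Fin 2))) 0) ∉ f.core := by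
  refine ⟨mem_range_self _, ?_⟩
  rw [f.mem_core_iff]
  rintro ⟨y, hy, he⟩
  have hinj := f.isSmoothEmbedding.isEmbedding.injective he
  subst hinj
  have hn : ‖radSched ρ₀ ρ₁ t • (θ : EuclideanSpace ℝ (Fin 2))‖ = radSched ρ₀ ρ₁ t :=
    norm_smul_coe_sphere' (radSched_pos h0 h1 t).le θ
  have hpos : 0 < 1 - 0 - ‖radSched ρ₀ ρ₁ t • (θ : EuclideanSpace ℝ (Fin 2))‖ ^ 2 := by
    rw [hn]; nlinarith [radSched_lt_one h0' h1' t, radSched_pos h0 h1 t]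
  change lamSq 2 (tubeVec (depthLine (uDir b θ) (radSched ρ₀ ρ₁ t • (θ : EuclideanSpace ℝ (Fin 2))) 0)) = 1 at hy
  rw [tubeVec_depthLine _ _ le_rfl hpos, lamSq_mkVec _ _ hpos.le, hn] at hy
  nlinarith [radSched_pos h0 h1 t]

/-! ### §3 The one-twist fibre framing is carried along the radial isotopy -/

omit [T2Space W] in
/-- **The one-twist fibre framing of the `ρ`-longitude is a framing of it in `∂W`** (`0 < ρ < 1`):
continuous into `TW`, tangent to `∂W`, nowhere tangent (read in `ℝ⁴`: `X_{θ²}` versus `2π V`). [folklore] -/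
theorem isKnotFraming_tubeFibreFraming_longitude {ρ : ℝ} (h0 : 0 < ρ) (h1 : ρ < 1) :
    IsKnotFraming (fun θ : sphere (0 : EuclideanSpace ℝ (Fin 2)) 1 =>
        f.toFun (depthLine (uDir b θ) (ρ • (θ : EuclideanSpace ℝ (Fin 2))) 0))
      fun θ => tubeFibreFraming f (uDir b θ) (ρ • (θ : EuclideanSpace ℝ (Fin 2))) (sqDir θ) := by
  haveI := Fact.mk (@finrank_euclideanSpace_fin ℝ _ 2)
  have hn : ∀ θ : sphere (0 : EuclideanSpace ℝ (Fin 2)) 1, ‖ρ • (θ : EuclideanSpace ℝ (Fin 2))‖ < 1 := fun θ => by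
    rw [norm_smul_coe_sphere' h0.le]; exact h1
  refine ⟨?_, fun θ => tubeFibreFraming_mem_boundaryTangentSpace f (uDir b θ) (hn θ) (sqDir θ), fun t => ?_⟩
  · have hv : Continuous fun u : sphere (0 : EuclideanSpace ℝ (Fin 2)) 1 => ρ • (u : EuclideanSpace ℝ (Fin 2)) :=
      (continuous_const (y := ρ)).smul continuous_subtype_val
    exact continuous_tubeFibreFraming f (contMDiff_uDir b).continuous hv contMDiff_sqDir.continuous hn
  · -- transversality at `θ = circlePt t`
    set θ : sphere (0 : EuclideanSpace ℝ (Fin 2)) 1 := circlePt t with hθ_def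
    set pt : ↥(handleTube 3 2) := tubeLongitudePt b ρ θ with hpt_def
    set Dι := closedBallCoeDeriv ((pt : ↥(handleTube 3 2)) : closedBall (0 : EuclideanSpace ℝ (Fin 4)) 1) with hDι
    have hθsq : (θ : EuclideanSpace ℝ (Fin 2)) 0 ^ 2 + (θ : EuclideanSpace ℝ (Fin 2)) 1 ^ 2 = 1 := by
      have h2 : ‖(θ : EuclideanSpace ℝ (Fin 2))‖ ^ 2 = 1 := by rw [norm_eq_of_mem_sphere θ, one_pow]
      rwa [EuclideanSpace.real_norm_sq_eq, Fin.sum_univ_two] at h2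
    have hKeq : (fun θ : sphere (0 : EuclideanSpace ℝ (Fin 2)) 1 =>
        f.toFun (depthLine (uDir b θ) (ρ • (θ : EuclideanSpace ℝ (Fin 2))) 0)) =
        fun θ => f.toFun (tubeLongitudePt b ρ θ) :=
      funext fun θ => by rw [depthLine_uDir_smul b h0.le h1 θ]
    have Lf_def : ∃ Lf : EuclideanSpace ℝ (Fin 4) →L[ℝ] EuclideanSpace ℝ (Fin 4),
        ∀ x, Lf x = mfderiv (𝓡∂ 4) (𝓡∂ 4) f.toFun pt (Dι.symm x) :=
      ⟨(mfderiv (𝓡∂ 4) (𝓡∂ 4) f.toFun pt).comp (Dι.symm : EuclideanSpace ℝ (Fin 4) →L[ℝ] EuclideanSpace ℝ (Fin 4)),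
        fun x => rfl⟩
    obtain ⟨Lf, hLf⟩ := Lf_def
    set X' : EuclideanSpace ℝ (Fin 4) := WithLp.toLp 2 (twistVec (slideSign b) ρ
      ((θ : EuclideanSpace ℝ (Fin 2)) 0) ((θ : EuclideanSpace ℝ (Fin 2)) 1)) with hX'
    set V' : EuclideanSpace ℝ (Fin 4) := WithLp.toLp 2 (longVelVec (slideSign b) ρ
      ((θ : EuclideanSpace ℝ (Fin 2)) 0) ((θ : EuclideanSpace ℝ (Fin 2)) 1)) with hV'
    have hvel : knotVelocity (fun θ : sphere (0 : EuclideanSpace ℝ (Fin 2)) 1 =>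
        f.toFun (depthLine (uDir b θ) (ρ • (θ : EuclideanSpace ℝ (Fin 2))) 0)) t = Lf ((2 * Real.pi) • V') := by
      rw [hKeq, hLf, knotVelocity_longitude f b h0.le h1 t]
    have hν : tubeFibreFraming f (uDir b θ) (ρ • (θ : EuclideanSpace ℝ (Fin 2))) (sqDir θ) = Lf X' := by
      rw [hLf, tubeFibreFraming_eq_mfderiv f (uDir b θ) (hn θ) (sqDir θ), fibreVec_longitude b h0.le θ]
      have key : ∀ (y : ↥(handleTube 3 2)) (_ : y = pt) (X : EuclideanSpace ℝ (Fin 4)),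
          mfderiv (𝓡∂ 4) (𝓡∂ 4) f.toFun y ((closedBallCoeDeriv ((y : ↥(handleTube 3 2)) :
            closedBall (0 : EuclideanSpace ℝ (Fin 4)) 1)).symm X) =
          mfderiv (𝓡∂ 4) (𝓡∂ 4) f.toFun pt (Dι.symm X) := by
        intro y e X; subst e; rfl
      exact key _ (depthLine_uDir_smul b h0.le h1 θ) _
    have hLinj : Injective Lf := fun x y hxy => by
      rw [hLf, hLf] at hxy
      exact Dι.symm.injective (injective_mfderiv_handleAttachingMap f pt hxy)
    rw [Submodule.mem_span_singleton, hvel, hν]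
    rintro ⟨μ, hμ⟩
    have e2 : Lf ((μ * (2 * Real.pi)) • V') = μ • Lf ((2 * Real.pi) • V') := by
      rw [map_smul, map_smul, smul_smul]
    have heq := hLinj (e2.trans hμ)
    have heq' := congrArg (WithLp.ofLp) heq
    simp only [hX', hV', WithLp.ofLp_smul] at heq'
    have hne := lincomb_ne_smul_longVelVec (slideSign_sq b) h0 h1 hθsq one_pos one_pos 0 (μ * (2 * Real.pi))
    apply hne
    rw [one_mul, one_mul, zero_smul, add_zero, ← twistVec_eq_lincomb]
    exact heq'.symm

/-- **The one-twist fibre framings are carried along the radial isotopy.** [cite: Kirby1989, Ch. I §2] -/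
theorem isFramingAlong_radial {ρ₀ ρ₁ : ℝ} (h0 : 0 < ρ₀) (h0' : ρ₀ < 1) (h1 : 0 < ρ₁) (h1' : ρ₁ < 1) :
    IsFramingAlong (radialIsotopy f b h0 h0' h1 h1')
      (fun θ => tubeFibreFraming f (uDir b θ) (ρ₀ • (θ : EuclideanSpace ℝ (Fin 2))) (sqDir θ))
      fun t θ => tubeFibreFraming f (uDir b θ) (radSched ρ₀ ρ₁ t • (θ : EuclideanSpace ℝ (Fin 2))) (sqDir θ) where
  apply_zero := by
    funext θ
    show tubeFibreFraming f (uDir b θ) (radSched ρ₀ ρ₁ 0 • (θ : EuclideanSpace ℝ (Fin 2))) (sqDir θ) = _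
    rw [radSched_zero]
  isKnotFraming t _ :=
    isKnotFraming_tubeFibreFraming_longitude f b (radSched_pos h0 h1 t) (radSched_lt_one h0' h1' t)
  continuousOn := by
    haveI := Fact.mk (@finrank_euclideanSpace_fin ℝ _ 2)
    have hn : ∀ p : ℝ × (sphere (0 : EuclideanSpace ℝ (Fin 2)) 1),
        ‖radSched ρ₀ ρ₁ p.1 • ((p.2 : sphere (0 : EuclideanSpace ℝ (Fin 2)) 1) : EuclideanSpace ℝ (Fin 2))‖ < 1 :=
      fun p => by
        rw [norm_smul_coe_sphere' (radSched_pos h0 h1 p.1).le]; exact radSched_lt_one h0' h1' p.1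
    have hv : Continuous fun p : ℝ × (sphere (0 : EuclideanSpace ℝ (Fin 2)) 1) =>
        radSched ρ₀ ρ₁ p.1 • ((p.2 : sphere (0 : EuclideanSpace ℝ (Fin 2)) 1) : EuclideanSpace ℝ (Fin 2)) :=
      ((contDiff_radSched ρ₀ ρ₁).continuous.comp continuous_fst).smul (continuous_subtype_val.comp continuous_snd)
    have hc := continuous_tubeFibreFraming f (X := ℝ × (sphere (0 : EuclideanSpace ℝ (Fin 2)) 1))
      ((contMDiff_uDir b).continuous.comp continuous_snd) hv
      (contMDiff_sqDir.continuous.comp continuous_snd) hn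
    exact hc.continuousOn

end Radial

/-! ### §4 Registered helper -/

/-- **Registered helper `helper_belt_radialIsotopy` (node T3c-1 of NF6 `stub_steinRealisation`, stage (3c)
first half, wave 3, lead c5): for a 2-handle attaching map `h̄ : T → W`, a direction flag `b` and radii
`ρ₀, ρ₁ ∈ (0, 1)`, the `h̄`-images of the `ρ₀`- and `ρ₁`-longitudes of the attaching circle are isotopic
through knots in `∂W` that stay in `h̄(T)` off the core — the stages being the intermediate longitudes —
the one-twist fibre framings (velocities of `ε ↦ h̄ (depthLine (uDir b θ) (ρ θ + ε θ²) 0)`) being carried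
along.** [cite: Kosinski1993, VI §6] -/
theorem helper_belt_radialIsotopy :
    ∀ {W : Type} [TopologicalSpace W] [T2Space W] [ChartedSpace (EuclideanHalfSpace 4) W] [IsManifold (𝓡∂ 4) ∞ W]
      (f : Literature.Topology.FourManifolds.HandleAttachingMap 3 2 W) (b : Bool) (ρ₀ ρ₁ : ℝ),
      0 < ρ₀ → ρ₀ < 1 → 0 < ρ₁ → ρ₁ < 1 →
      ∃ (Φ : Literature.Geometry.Symplectic.KnotIsotopyInBoundary
          (fun θ => f.toFun (Summit.SmoothPoincare4.SmoothPoincare4.Theorems.AcyclicBisectionExists.ModpBraidOrbits.tubeLongitudePt b ρ₀ θ))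
          (fun θ => f.toFun (Summit.SmoothPoincare4.SmoothPoincare4.Theorems.AcyclicBisectionExists.ModpBraidOrbits.tubeLongitudePt b ρ₁ θ)))
        (ρ : ℝ → ℝ),
        ρ 0 = ρ₀ ∧ ρ 1 = ρ₁ ∧ (∀ t, 0 < ρ t ∧ ρ t < 1) ∧
        (∀ t θ, Φ.toFun t θ = f.toFun (Literature.Topology.FourManifolds.depthLine
          (Summit.SmoothPoincare4.SmoothPoincare4.Theorems.AcyclicBisectionExists.ModpBraidOrbits.uDir b θ)
          (ρ t • (θ : EuclideanSpace ℝ (Fin 2))) 0)) ∧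
        (∀ t θ, Φ.toFun t θ ∈ Set.range f.toFun ∧ Φ.toFun t θ ∉ f.core) ∧
        Literature.Geometry.Symplectic.IsFramingAlong Φ
          (fun θ => mfderiv 𝓘(ℝ, ℝ) (𝓡∂ 4) (fun ε : ℝ => f.toFun (Literature.Topology.FourManifolds.depthLine
            (Summit.SmoothPoincare4.SmoothPoincare4.Theorems.AcyclicBisectionExists.ModpBraidOrbits.uDir b θ)
            (ρ₀ • (θ : EuclideanSpace ℝ (Fin 2)) +
              ε • Summit.SmoothPoincare4.SmoothPoincare4.Theorems.AcyclicBisectionExists.ModpBraidOrbits.sqDir θ) 0)) 0 (1 : ℝ))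
          (fun t θ => mfderiv 𝓘(ℝ, ℝ) (𝓡∂ 4) (fun ε : ℝ => f.toFun (Literature.Topology.FourManifolds.depthLine
            (Summit.SmoothPoincare4.SmoothPoincare4.Theorems.AcyclicBisectionExists.ModpBraidOrbits.uDir b θ)
            (ρ t • (θ : EuclideanSpace ℝ (Fin 2)) +
              ε • Summit.SmoothPoincare4.SmoothPoincare4.Theorems.AcyclicBisectionExists.ModpBraidOrbits.sqDir θ) 0)) 0 (1 : ℝ)) := by
  intro W _ _ _ _ f b ρ₀ ρ₁ h0 h0' h1 h1'
  exact ⟨radialIsotopy f b h0 h0' h1 h1', radSched ρ₀ ρ₁, radSched_zero ρ₀ ρ₁, radSched_one ρ₀ ρ₁,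
    fun t => ⟨radSched_pos h0 h1 t, radSched_lt_one h0' h1' t⟩, fun t θ => rfl,
    fun t θ => radialIsotopy_mem f b h0 h0' h1 h1' t θ, isFramingAlong_radial f b h0 h0' h1 h1'⟩

end Summit.SmoothPoincare4.SmoothPoincare4.Theorems.AcyclicBisectionExists.ModpBraidOrbits

end
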